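import Summits.ValiantsHypothesis.ValiantsHypothesis.Theorems.PolyaContinuedMonotoneCoverHardOneLevel
import Summits.ValiantsHypothesis.ValiantsHypothesis.Theorems.PolyaContinuedMonotoneCoverHardHardLanesSpecialize

/-!
# Crux `MonotoneCoverHard` (stmt-ValiantsHypothesis-7421), width line — «THREE HARD LANES ⇒ NOT PFAFFIAN»

Kernel proof (val-width-7421-p3 g0) of the conjecture recorded by val-width-7421-p2 in
`Cruxes/MonotoneCoverHard/CALIBRATION-few_state_cut.md` §F as first concrete target for the width bet:
**no label-bijective Pfaffian cover `(m, E, a)` of `per_n` has rows `u₀, u₁, u₂` and distinct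
label-rows `e₀, e₁, e₂` such that in every weight-nonzero perfect matching the edge at `u_t` carries a
variable of label-row `e_t`** (`no_threeHardLanes_pfaffian_cover`; any `m`, any `n`).

Proof — the `K_{3,3}` obstruction without `K_{3,3}`, by determinantal complexity.  A Pólya signing gives
`per_n = det M` (`det_signedLabel_eq_perPoly`).  Label-row uniqueness inside each matching
(`exists_perm_labels`) shows the rows `u_t` hold only variables `x_{e_t,·}` and no other row holds any.
Fix a weight-nonzero `τ₀` with permutation `σ₀` and SPECIALISE (`aeval_perPoly_specialize`):
`x_{e_t, σ₀ e_{t'}} ↦ X (t,t')`, other `x_{e_t,·} ↦ 0`, `x_{k, σ₀ k} ↦ 1`, other `x_{k,·} ↦ 0`; then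
`per_n ↦ per_3`, the lane rows stay affine-linear and ALL OTHER ROWS BECOME CONSTANT.  After permuting
columns by `τ₀`, the constant block `D` on the non-lane rows has `det D ≠ 0`: a permutation `π ≠ 1`
contributing to `det D` re-routes the non-lane rows of `τ₀` into another weight-nonzero matching `τ'`
equal to `τ₀` on the lanes; `τ' ≠ τ₀` forces its permutation `σ' ≠ σ₀` (`eq_of_perm_labels_eq`) at a
non-lane label-row, whose label the specialisation kills.  One Schur step with pivot `D`
(`det_eq_C_mul_det_schur`, `totalDegree_schur_le`) leaves `per_3 = c · det L` with `L` a `3 × 3`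
matrix of affine-linear forms: `dc(per_3) ≤ 3`, against Mignon–Ressayre (`9 ≤ 6`).

This does not prove `stub_width` (parallel tokens may rotate among rows and mix label-rows); it makes
the card's «K_{3,3}-type coupling» clause unconditional for permanent row-pure lanes.  VP ≠ VNP is not
moved; `MonotoneCoverHard` stays open.  No definitions.
-/

namespace Summit.ValiantsHypothesis.ValiantsHypothesis.Theorems.PolyaContinuedMonotoneCoverHard

-- summit = sub-problem name (single-conjunct summit, D-0017 layout), so the namespace repeats it
set_option linter.dupNamespace false

open scoped Classical
open Finset
open Literature.Combinatorics.SimpleGraph (IsPolyaSigning)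
open Literature.Computability.AlgebraicComplexity (HasDetRepr sq_le_two_mul_of_hasDetRepr_perPoly)
open Summit.ValiantsHypothesis.ValiantsHypothesis.Theorems.PolyaContinued.MonotoneCoverHardRectangle
  (exists_labels aeval_permanent_cover perPoly_eq_sum_monomial label_bijection pexp_injective)

/-- **Three hard lanes are impossible in a Pfaffian cover.**  No label-bijective Pfaffian cover of
`per_n` has three rows `u t` (`t < 3`) and three distinct label-rows `e t` such that in every
weight-nonzero perfect matching the edge at `u t` carries a variable of label-row `e t`. -/
theorem no_threeHardLanes_pfaffian_cover (n m : ℕ) (E : Finset (Fin m × Fin m))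
    (a : Fin m × Fin m → MvPolynomial (Fin n × Fin n) ℂ)
    (hsig : ∃ s : Fin m × Fin m → ℂ, (∀ e, s e = 1 ∨ s e = -1) ∧
      (Matrix.of fun i j => if (i, j) ∈ E then MvPolynomial.C (s (i, j)) * MvPolynomial.X (i, j)
          else 0 : Matrix (Fin m) (Fin m) (MvPolynomial (Fin m × Fin m) ℂ)).det =
        (Matrix.of fun i j => if (i, j) ∈ E then MvPolynomial.X (i, j) else 0 :
          Matrix (Fin m) (Fin m) (MvPolynomial (Fin m × Fin m) ℂ)).permanent)
    (ha : ∀ e, (∃ j, a e = MvPolynomial.X j) ∨ a e = 0 ∨ a e = 1)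
    (hper : Literature.Computability.AlgebraicComplexity.perPoly (Fin n) ℂ =
      MvPolynomial.aeval a (Matrix.of fun i j => if (i, j) ∈ E then MvPolynomial.X (i, j) else 0 :
          Matrix (Fin m) (Fin m) (MvPolynomial (Fin m × Fin m) ℂ)).permanent)
    (u : Fin 3 → Fin m) (e : Fin 3 → Fin n) (he : Function.Injective e)
    (hlane : ∀ τ : Equiv.Perm (Fin m), (∀ i, (i, τ i) ∈ E ∧ a (i, τ i) ≠ 0) →
      ∀ t, ∃ l, a (u t, τ (u t)) = MvPolynomial.X (e t, l)) : False := by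
  -- a weight-nonzero perfect matching `τ₀` and its permutation `σ₀`
  obtain ⟨τ₀, hτ₀⟩ : ∃ τ₀ : Equiv.Perm (Fin m), ∀ i, (i, τ₀ i) ∈ E ∧ a (i, τ₀ i) ≠ 0 := by
    obtain ⟨δ, hδ, -, -⟩ := exists_labels a ha
    set G := univ.filter fun τ : Equiv.Perm (Fin m) => ∀ i, (i, τ i) ∈ E ∧ a (i, τ i) ≠ 0 with hG
    have hsum : ∑ τ ∈ G, MvPolynomial.monomial (∑ i, δ (i, τ i)) (1 : ℂ) =
        ∑ σ : Equiv.Perm (Fin n), MvPolynomial.monomial (∑ k, Finsupp.single (k, σ k) 1) (1 : ℂ) := by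
      rw [← aeval_permanent_cover E a δ hδ G hG, ← hper, perPoly_eq_sum_monomial]
    obtain ⟨-, -, hsurj⟩ := label_bijection G (fun τ => ∑ i, δ (i, τ i))
      (fun σ : Equiv.Perm (Fin n) => ∑ k, Finsupp.single (k, σ k) (1 : ℕ)) pexp_injective hsum
    obtain ⟨τ, hτG, -⟩ := hsurj 1
    rw [hG] at hτG
    exact ⟨τ, (mem_filter.1 hτG).2⟩
  obtain ⟨σ₀, h01, h02⟩ := exists_perm_labels E a ha hper τ₀ hτ₀
  -- lane facts
  have hlane₀ : ∀ t, a (u t, τ₀ (u t)) = MvPolynomial.X (e t, σ₀ (e t)) := by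
    intro t
    obtain ⟨l, hl⟩ := hlane τ₀ hτ₀ t
    have := h01 (u t) (e t, l) hl
    dsimp only at this
    rw [hl, this]
  -- (H2) a used edge carrying label-row `e t` sits at row `u t`
  have hH2 : ∀ (τ : Equiv.Perm (Fin m)), (∀ i, (i, τ i) ∈ E ∧ a (i, τ i) ≠ 0) →
      ∀ i t l, a (i, τ i) = MvPolynomial.X (e t, l) → i = u t := by
    intro τ hτ i t l hil
    obtain ⟨σ, h1, h2⟩ := exists_perm_labels E a ha hper τ hτ
    obtain ⟨l', hl'⟩ := hlane τ hτ t
    have e1 : σ (e t) = l := h1 i (e t, l) hil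
    have e2 : σ (e t) = l' := h1 (u t) (e t, l') hl'
    obtain ⟨i₀, -, huniq⟩ := h2 (e t)
    have hi : i = i₀ := huniq i (show a (i, τ i) = MvPolynomial.X (e t, σ (e t)) by rw [hil, ← e1])
    have hu : u t = i₀ :=
      huniq (u t) (show a (u t, τ (u t)) = MvPolynomial.X (e t, σ (e t)) by rw [hl', ← e2])
    rw [hi, hu]
  have hUinj : Function.Injective u := by
    intro t t' h
    obtain ⟨l, hl⟩ := hlane τ₀ hτ₀ t
    have := hH2 τ₀ hτ₀ (u t) t' (σ₀ (e t')) (by rw [h]; exact hlane₀ t')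
    -- `this : u t = u t'`; labels at the common row force `e t = e t'`
    have h2 : MvPolynomial.X (e t, σ₀ (e t)) = (MvPolynomial.X (e t', σ₀ (e t')) :
        MvPolynomial (Fin n × Fin n) ℂ) := by rw [← hlane₀ t, ← hlane₀ t', h]
    exact he (Prod.ext_iff.1 (MvPolynomial.X_injective h2)).1
  -- the specialisation
  obtain ⟨f, hf1, hf2, hf3, hf4⟩ := exists_laplace_specialization e he σ₀
  set φ : MvPolynomial (Fin n × Fin n) ℂ →+* MvPolynomial (Fin 3 × Fin 3) ℂ :=
    (MvPolynomial.aeval f).toRingHom with hφ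
  have hφa : ∀ p, φ p = MvPolynomial.aeval f p := fun p => rfl
  have hφper : φ (Literature.Computability.AlgebraicComplexity.perPoly (Fin n) ℂ) =
      Literature.Computability.AlgebraicComplexity.perPoly (Fin 3) ℂ := by
    rw [hφa]; exact aeval_perPoly_specialize e he σ₀ f hf1 hf2 hf3 hf4
  -- Pólya signing, signed label matrix, its specialisation `M'`
  obtain ⟨s, hs⟩ := exists_polyaSigning_of_symbolic E hsig
  obtain ⟨M, hM⟩ : ∃ M : Matrix (Fin m) (Fin m) (MvPolynomial (Fin n × Fin n) ℂ),
      ∀ i j, M i j = if ∃ τ : Equiv.Perm (Fin m), (∀ k, (k, τ k) ∈ E ∧ a (k, τ k) ≠ 0) ∧ τ i = j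
        then MvPolynomial.C ((s (i, j) : ℤ) : ℂ) * a (i, j) else 0 :=
    ⟨fun i j => if ∃ τ : Equiv.Perm (Fin m), (∀ k, (k, τ k) ∈ E ∧ a (k, τ k) ≠ 0) ∧ τ i = j
        then MvPolynomial.C ((s (i, j) : ℤ) : ℂ) * a (i, j) else 0, fun _ _ => rfl⟩
  have hdetM := det_signedLabel_eq_perPoly E a hper s hs M hM
  set M' : Matrix (Fin m) (Fin m) (MvPolynomial (Fin 3 × Fin 3) ℂ) := φ.mapMatrix M with hM'def
  have hM' : ∀ i j, M' i j =
      if ∃ τ : Equiv.Perm (Fin m), (∀ k, (k, τ k) ∈ E ∧ a (k, τ k) ≠ 0) ∧ τ i = j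
      then MvPolynomial.C ((s (i, j) : ℤ) : ℂ) * φ (a (i, j)) else 0 := by
    intro i j
    rw [hM'def, RingHom.mapMatrix_apply, Matrix.map_apply, hM]
    split_ifs
    · rw [map_mul, hφa, hφa, MvPolynomial.aeval_C]; rfl
    · exact map_zero φ
  have hdetM' : M'.det = Literature.Computability.AlgebraicComplexity.perPoly (Fin 3) ℂ := by
    rw [hM'def, ← RingHom.map_det, hdetM, hφper]
  -- used edges
  have hK1 : ∀ i j, (∃ τ : Equiv.Perm (Fin m), (∀ k, (k, τ k) ∈ E ∧ a (k, τ k) ≠ 0) ∧ τ i = j) →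
      ((i, j) ∈ E ∧ a (i, j) ≠ 0) ∧
      (∀ t l, a (i, j) = MvPolynomial.X (e t, l) → i = u t) ∧
      (∀ t, i = u t → ∃ l, a (i, j) = MvPolynomial.X (e t, l)) := by
    rintro i j ⟨τ, hτ, rfl⟩
    refine ⟨hτ i, fun t l h => hH2 τ hτ i t l h, fun t hit => ?_⟩
    subst hit; exact hlane τ hτ t
  have hK2 : ∀ e', a e' ≠ 0 → (¬ ∃ k, a e' = MvPolynomial.X k) → a e' = 1 := by
    intro e' h1 h2
    rcases ha e' with h | h | h
    · exact absurd h h2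
    · exact absurd h h1
    · exact h
  have hunit : ∀ e', ((s e' : ℤ) : ℂ) ≠ 0 := fun e' => by
    rcases Int.units_eq_one_or (s e') with h | h <;> simp [h]
  -- specialised labels off the lanes are the constants `0`, `1`
  have hφconst : ∀ i j, (∀ t, i ≠ u t) →
      (∃ τ : Equiv.Perm (Fin m), (∀ k, (k, τ k) ∈ E ∧ a (k, τ k) ≠ 0) ∧ τ i = j) →
      φ (a (i, j)) = MvPolynomial.C (MvPolynomial.coeff 0 (φ (a (i, j)))) := by
    intro i j hi hu
    by_cases hv : ∃ k, a (i, j) = MvPolynomial.X k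
    · obtain ⟨⟨k, l⟩, hk⟩ := hv
      have hke : ∀ t, k ≠ e t := fun t hkt => hi t ((hK1 i j hu).2.1 t l (by rw [hk, hkt]))
      rw [hk, hφa, MvPolynomial.aeval_X]
      by_cases hl : l = σ₀ k
      · rw [hl, hf3 k hke, MvPolynomial.coeff_zero_one, MvPolynomial.C_1]
      · rw [hf4 k l hke hl, MvPolynomial.coeff_zero, MvPolynomial.C_0]
    · rw [hK2 _ (hK1 i j hu).1.2 hv, map_one, MvPolynomial.coeff_zero_one, MvPolynomial.C_1]
  -- specialised labels on the lanes have degree ≤ 1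
  have hφdeg : ∀ i j,
      (∃ τ : Equiv.Perm (Fin m), (∀ k, (k, τ k) ∈ E ∧ a (k, τ k) ≠ 0) ∧ τ i = j) →
      (φ (a (i, j))).totalDegree ≤ 1 := by
    intro i j hu
    by_cases hi : ∃ t, i = u t
    · obtain ⟨t, rfl⟩ := hi
      obtain ⟨l, hl⟩ := (hK1 _ j hu).2.2 t rfl
      rw [hl, hφa, MvPolynomial.aeval_X]
      by_cases hl' : ∃ t', l = σ₀ (e t')
      · obtain ⟨t', rfl⟩ := hl'
        rw [hf1]; exact (MvPolynomial.totalDegree_X _).le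
      · rw [hf2 t l fun t' h => hl' ⟨t', h⟩, MvPolynomial.totalDegree_zero]; exact Nat.zero_le _
    · have hi' : ∀ t, i ≠ u t := fun t h => hi ⟨t, h⟩
      rw [hφconst i j hi' hu, MvPolynomial.totalDegree_C]; exact Nat.zero_le _
  -- the column-permuted matrix and its constant companion
  set M₁ : Matrix (Fin m) (Fin m) (MvPolynomial (Fin 3 × Fin 3) ℂ) := M'.submatrix id τ₀ with hM₁def
  have hM₁ : ∀ i i', M₁ i i' =
      if ∃ τ : Equiv.Perm (Fin m), (∀ k, (k, τ k) ∈ E ∧ a (k, τ k) ≠ 0) ∧ τ i = τ₀ i'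
      then MvPolynomial.C ((s (i, τ₀ i') : ℤ) : ℂ) * φ (a (i, τ₀ i')) else 0 := fun i i' => by
    rw [hM₁def, Matrix.submatrix_apply]; exact hM' i (τ₀ i')
  have hdet₁ : M₁.det = ((Equiv.Perm.sign τ₀ : ℤ) : MvPolynomial (Fin 3 × Fin 3) ℂ) * M'.det :=
    Matrix.det_permute' τ₀ M'
  obtain ⟨Sf, hSf⟩ : ∃ Sf : Matrix (Fin m) (Fin m) ℂ, ∀ i i', Sf i i' =
      if ∃ τ : Equiv.Perm (Fin m), (∀ k, (k, τ k) ∈ E ∧ a (k, τ k) ≠ 0) ∧ τ i = τ₀ i'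
      then ((s (i, τ₀ i') : ℤ) : ℂ) * MvPolynomial.coeff 0 (φ (a (i, τ₀ i'))) else 0 :=
    ⟨fun i i' => if ∃ τ : Equiv.Perm (Fin m), (∀ k, (k, τ k) ∈ E ∧ a (k, τ k) ≠ 0) ∧ τ i = τ₀ i'
      then ((s (i, τ₀ i') : ℤ) : ℂ) * MvPolynomial.coeff 0 (φ (a (i, τ₀ i'))) else 0,
      fun _ _ => rfl⟩
  have hrowconst : ∀ i i', (∀ t, i ≠ u t) → M₁ i i' = MvPolynomial.C (Sf i i') := by
    intro i i' hi
    rw [hM₁, hSf]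
    split_ifs with hu
    · have h := hφconst i _ hi hu
      rw [map_mul, ← h]
    · exact MvPolynomial.C_0.symm
  have hdeg : ∀ i i', (M₁ i i').totalDegree ≤ 1 := by
    intro i i'
    rw [hM₁]
    split_ifs with hu
    · calc (MvPolynomial.C ((s (i, τ₀ i') : ℤ) : ℂ) * φ (a (i, τ₀ i'))).totalDegree
          ≤ (MvPolynomial.C ((s (i, τ₀ i') : ℤ) : ℂ) : MvPolynomial (Fin 3 × Fin 3) ℂ).totalDegree +
            (φ (a (i, τ₀ i'))).totalDegree := MvPolynomial.totalDegree_mul _ _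
        _ ≤ 0 + 1 := Nat.add_le_add (le_of_eq (MvPolynomial.totalDegree_C _)) (hφdeg i _ hu)
        _ = 1 := rfl
    · rw [MvPolynomial.totalDegree_zero]; exact Nat.zero_le _
  /- the idle block on the non-lane rows is unimodular -/
  obtain ⟨p, hp⟩ : ∃ p : Fin m → Prop, ∀ i, p i ↔ ∀ t, i ≠ u t := ⟨_, fun _ => Iff.rfl⟩
  set S : Matrix {i // p i} {i // p i} ℂ := Matrix.of fun i i' => Sf i i' with hS
  have hSdet : S.det ≠ 0 := by
    rw [Matrix.det_apply', Finset.sum_eq_single (1 : Equiv.Perm {i // p i})]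
    · -- the identity term is `∏ s (i, τ₀ i)`
      simp only [Equiv.Perm.sign_one, Units.val_one, Int.cast_one, one_mul, Equiv.Perm.one_apply]
      refine Finset.prod_ne_zero_iff.2 fun i _ => ?_
      rw [hS, Matrix.of_apply, hSf, if_pos ⟨τ₀, hτ₀, rfl⟩]
      refine mul_ne_zero (hunit _) ?_
      -- the `τ₀`-label at a non-lane row specialises to `1`
      have hi : ∀ t, (i : Fin m) ≠ u t := (hp i).1 i.2
      by_cases hv : ∃ k, a ((i : Fin m), τ₀ i) = MvPolynomial.X k
      · obtain ⟨⟨k, l⟩, hk⟩ := hv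
        have hke : ∀ t, k ≠ e t :=
          fun t hkt => hi t ((hK1 _ _ ⟨τ₀, hτ₀, rfl⟩).2.1 t l (by rw [hk, hkt]))
        have hl : l = σ₀ k := (h01 i (k, l) hk).symm
        rw [hk, hl, hφa, MvPolynomial.aeval_X, hf3 k hke]
        simp
      · rw [hK2 _ (hτ₀ i).2 hv, map_one]
        simp
    · -- a permutation `π ≠ 1` of the non-lane rows contributes nothing
      intro π _ hπ
      by_contra hne
      have hprod : ∀ i : {i // p i}, S (π i) i ≠ 0 := by
        intro i h0
        exact hne (by rw [Finset.prod_eq_zero (f := fun j => S (π j) j) (Finset.mem_univ i) h0,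
          mul_zero])
      have hused : ∀ i : {i // p i}, (∃ τ : Equiv.Perm (Fin m),
          (∀ k, (k, τ k) ∈ E ∧ a (k, τ k) ≠ 0) ∧ τ (π i) = τ₀ i) ∧
          MvPolynomial.coeff 0 (φ (a ((π i : Fin m), τ₀ i))) ≠ 0 := by
        intro i
        have h := hprod i
        rw [hS, Matrix.of_apply, hSf] at h
        by_cases hu : ∃ τ : Equiv.Perm (Fin m),
            (∀ k, (k, τ k) ∈ E ∧ a (k, τ k) ≠ 0) ∧ τ (π i) = τ₀ i
        · rw [if_pos hu] at h
          exact ⟨hu, fun h0 => h (by rw [h0, mul_zero])⟩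
        · exact absurd (if_neg hu) h
      -- the re-routed matching
      set τ' : Equiv.Perm (Fin m) := τ₀ * Equiv.Perm.ofSubtype π⁻¹ with hτ'
      have hτ'Z : ∀ x : {i // p i}, τ' x = τ₀ ((π⁻¹ x : {i // p i}) : Fin m) := by
        intro x
        rw [hτ', Equiv.Perm.mul_apply, Equiv.Perm.ofSubtype_apply_coe]
      have hτ'nZ : ∀ j, ¬ p j → τ' j = τ₀ j := by
        intro j hj
        rw [hτ', Equiv.Perm.mul_apply, Equiv.Perm.ofSubtype_apply_of_not_mem _ hj]
      have hgood' : ∀ j, (j, τ' j) ∈ E ∧ a (j, τ' j) ≠ 0 := by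
        intro j
        by_cases hj : p j
        · obtain ⟨⟨τ, hτ, hτj⟩, -⟩ := hused (π⁻¹ ⟨j, hj⟩)
          have e2 : π (π⁻¹ ⟨j, hj⟩) = ⟨j, hj⟩ := by simp
          rw [e2] at hτj
          have e1 : τ' j = τ₀ ((π⁻¹ ⟨j, hj⟩ : {i // p i}) : Fin m) := hτ'Z ⟨j, hj⟩
          rw [e1, ← hτj]
          exact hτ j
        · rw [hτ'nZ j hj]; exact hτ₀ j
      obtain ⟨σ', h1', h2'⟩ := exists_perm_labels E a ha hper τ' hgood'
      -- `τ'` agrees with `τ₀` on the lanes, so `σ'` agrees with `σ₀` on their label-rows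
      have hσ'e : ∀ t, σ' (e t) = σ₀ (e t) := by
        intro t
        have hut : ¬ p (u t) := fun h => (hp _).1 h t rfl
        have := hlane₀ t
        rw [← hτ'nZ (u t) hut] at this
        exact h1' (u t) (e t, σ₀ (e t)) this
      by_cases hσ : σ' = σ₀
      · -- then `τ' = τ₀`, so `π = 1`
        have heq : τ' = τ₀ :=
          eq_of_perm_labels_eq E a ha hper σ₀ τ' τ₀ hgood' hτ₀ (by rw [← hσ]; exact h1') h01
        apply hπ
        refine Equiv.ext fun x => ?_
        have e1 : τ₀ (x : Fin m) = τ₀ ((π⁻¹ x : {i // p i}) : Fin m) := by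
          conv_lhs => rw [← heq]
          exact hτ'Z x
        have e2 : (x : Fin m) = ((π⁻¹ x : {i // p i}) : Fin m) := τ₀.injective e1
        have e3 : π⁻¹ x = x := (Subtype.ext e2).symm
        have e4 : π (π⁻¹ x) = x := by simp
        rw [e3] at e4
        rw [Equiv.Perm.one_apply]
        exact e4
      · -- otherwise some non-lane label of `τ'` is killed by the specialisation
        obtain ⟨k, hk⟩ : ∃ k, σ' k ≠ σ₀ k := by
          by_contra h
          exact hσ (Equiv.ext fun k => by by_contra hk; exact h ⟨k, hk⟩)
        have hke : ∀ t, k ≠ e t := fun t hkt => hk (by rw [hkt]; exact hσ'e t)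
        obtain ⟨i₀, hi₀, -⟩ := h2' k
        -- `i₀` is a non-lane row
        have hpi₀ : p i₀ := by
          rw [hp]
          intro t hit
          have := (hK1 i₀ (τ' i₀) ⟨τ', hgood', rfl⟩).2.2 t hit
          obtain ⟨l, hl⟩ := this
          rw [hi₀] at hl
          exact hke t (Prod.ext_iff.1 (MvPolynomial.X_injective hl)).1
        obtain ⟨-, hc⟩ := hused (π⁻¹ ⟨i₀, hpi₀⟩)
        have e2 : π (π⁻¹ ⟨i₀, hpi₀⟩) = ⟨i₀, hpi₀⟩ := by simp
        rw [e2] at hc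
        have e1 : τ₀ ((π⁻¹ ⟨i₀, hpi₀⟩ : {i // p i}) : Fin m) = τ' i₀ := (hτ'Z ⟨i₀, hpi₀⟩).symm
        apply hc
        change MvPolynomial.coeff 0 (φ (a (i₀, τ₀ ((π⁻¹ ⟨i₀, hpi₀⟩ : {i // p i}) : Fin m)))) = 0
        rw [e1, hi₀, hφa, MvPolynomial.aeval_X, hf4 k _ hke hk, MvPolynomial.coeff_zero]
    · intro h; exact absurd (Finset.mem_univ _) h
  /- one Schur step with the constant pivot -/
  have hstep := det_eq_C_mul_det_schur M₁ p S hSdet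
    (fun i j => by rw [hS, Matrix.of_apply]; exact hrowconst i j ((hp _).1 i.2))
  set L : Matrix {i // ¬ p i} {i // ¬ p i} (MvPolynomial (Fin 3 × Fin 3) ℂ) :=
    Matrix.of fun (i j : {i // ¬ p i}) => M₁ i j -
      ∑ l : {i // p i}, ∑ k : {i // p i}, M₁ i k * MvPolynomial.C (S⁻¹ k l) * M₁ l j with hL
  have hLdeg : ∀ i j, (L i j).totalDegree ≤ 1 := fun i j => by
    rw [hL, Matrix.of_apply]
    exact totalDegree_schur_le M₁ p S⁻¹ 1 0 (by norm_num) hdeg (fun i k => hdeg i k)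
      (fun l j => le_of_eq (by rw [hrowconst l j ((hp _).1 l.2), MvPolynomial.totalDegree_C])) i j
  -- `per_3 = C c · det L`
  set c : ℂ := ((Equiv.Perm.sign τ₀ : ℤ) : ℂ) * S.det with hc
  have hcne : c ≠ 0 := by
    refine mul_ne_zero ?_ hSdet
    rcases Int.units_eq_one_or (Equiv.Perm.sign τ₀) with h | h <;> simp [h]
  have hsignsq : ((Equiv.Perm.sign τ₀ : ℤ) : MvPolynomial (Fin 3 × Fin 3) ℂ) *
      ((Equiv.Perm.sign τ₀ : ℤ) : MvPolynomial (Fin 3 × Fin 3) ℂ) = 1 := by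
    rw [← Int.cast_mul, ← Units.val_mul, Int.units_mul_self, Units.val_one, Int.cast_one]
  have hperL : Literature.Computability.AlgebraicComplexity.perPoly (Fin 3) ℂ =
      MvPolynomial.C c * L.det := by
    have h1 : M'.det = ((Equiv.Perm.sign τ₀ : ℤ) : MvPolynomial (Fin 3 × Fin 3) ℂ) * M₁.det := by
      rw [hdet₁, ← mul_assoc, hsignsq, one_mul]
    rw [← hdetM', h1, hstep, hc, map_mul,
      ← map_intCast (MvPolynomial.C : ℂ →+* MvPolynomial (Fin 3 × Fin 3) ℂ)]
    ring
  -- the lanes are three rows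
  have hcardA : Fintype.card {i // ¬ p i} = 3 := by
    have h1 : (univ.filter fun i : Fin m => ¬ p i) = univ.image u := by
      ext i
      simp only [mem_filter, mem_univ, true_and, mem_image, hp, not_forall, not_not]
      constructor
      · rintro ⟨t, ht⟩; exact ⟨t, ht.symm⟩
      · rintro ⟨t, ht⟩; exact ⟨t, ht.symm⟩
    rw [Fintype.card_subtype, h1, card_image_of_injective _ hUinj, card_univ, Fintype.card_fin]
  have e₄ : {i // ¬ p i} ≃ Fin 3 := Fintype.equivFinOfCardEq hcardA
  set F₀ : Matrix (Fin 3) (Fin 3) (MvPolynomial (Fin 3 × Fin 3) ℂ) := L.submatrix e₄.symm e₄.symm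
    with hF₀
  have hF₀det : F₀.det = L.det := Matrix.det_submatrix_equiv_self e₄.symm L
  set F : Matrix (Fin 3) (Fin 3) (MvPolynomial (Fin 3 × Fin 3) ℂ) :=
    F₀.updateRow 0 ((MvPolynomial.C c : MvPolynomial (Fin 3 × Fin 3) ℂ) • F₀ 0) with hF
  have hFdet : F.det = MvPolynomial.C c * F₀.det := by
    rw [hF, Matrix.det_updateRow_smul, Matrix.updateRow_eq_self]
  have hFdeg : ∀ i j, (F i j).totalDegree ≤ 1 := by
    intro i j
    by_cases hi : i = 0
    · subst hi
      rw [hF, Matrix.updateRow_self, Pi.smul_apply, smul_eq_mul]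
      calc (MvPolynomial.C c * F₀ 0 j).totalDegree
          ≤ (MvPolynomial.C c : MvPolynomial (Fin 3 × Fin 3) ℂ).totalDegree +
            (F₀ 0 j).totalDegree := MvPolynomial.totalDegree_mul _ _
        _ ≤ 0 + 1 := Nat.add_le_add (le_of_eq (MvPolynomial.totalDegree_C _))
            (by rw [hF₀, Matrix.submatrix_apply]; exact hLdeg _ _)
        _ = 1 := rfl
    · rw [hF, Matrix.updateRow_ne hi, hF₀, Matrix.submatrix_apply]
      exact hLdeg _ _
  have hrepr : HasDetRepr (Literature.Computability.AlgebraicComplexity.perPoly (Fin (0 + 3)) ℂ)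
      3 :=
    ⟨F, fun i j => hFdeg i j, by rw [hFdet, hF₀det, ← hperL]⟩
  have hsq := sq_le_two_mul_of_hasDetRepr_perPoly hrepr
  omega

end Summit.ValiantsHypothesis.ValiantsHypothesis.Theorems.PolyaContinuedMonotoneCoverHard
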